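import Summits.QuantumFields.BalabanUV.Beta.EriceFlowEnclosureLowerAtZero
import Summits.QuantumFields.BalabanUV.Beta.EriceFlowEnclosureLowerNoGo

/-!
# Beta / EriceFlowEnclosureLowerAtZeroSharp — the hypotheses of `EriceFlowEnclosureLowerAtZero` §1 are SHARP: the travelling bump
# of `EriceFlowEnclosureLowerNoGo` is not equicontinuous at zero coupling along any tail (β-flow team, prover 2 = lower-bound ∕
# positivity side, unit `b2b-balaban-beta-bflow-p2`, gen 2; coordinator ruling e34b3e0c item (1))

HONEST FRAMING: discharging `BetaPertH` makes Bałaban's UV stability UNCONDITIONAL — a real constructive-QFT result; it is NOT the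
continuum limit and NOT the Clay problem.  HONEST DEPENDENCY: «continuum YM on T⁴ ⇐ BetaPertH ∧ nine spine estimates (0/9 proved);
BetaPertH ⇐ (D1) ∧ (D4) ∧ CAP+tail; G-an2-4 gates asym, D1 and NE2/3/4.»  This module is a KERNEL NEGATIVE about a toy family (our
object `EriceFlowEnclosureLowerNoGo.bump`, β_n(s) = −1 + 4ns/(1+(ns)²)); nothing of Bałaban's β-functions is asserted or denied.

WHAT IT PROVES.  `EriceFlowEnclosureLowerAtZero.sandwich369_of_equicontAtZero` derives Erice's (3.69) from three inputs: the eventual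
SIGN at zero coupling, the uniform BOUND, and the EQUICONTINUITY AT ZERO of the tail family {β_n}_{n ≥ n₀}.  The bump meets the first
two for every n (`bump_zero`: β_n(0) = −1; `bump_mem_Icc`: |β_n| ≤ 1) and every typed pre-(3.69) shape (`bump_unifBoundedConvergent369`,
`bump_negativeNearZero369`, `bump_continuous`), and violates (3.69) (`bump_not_sandwich369`) and [I] Thm 2's first sentence for every
forward-generated construction (prover 1's `EriceFlowEnclosureNecessity.not_endpointExistence_of_forwardGenerated_bump`).  Here:
`bump_not_equicontAtZero` — for every n₀ and η > 0 some n ≥ n₀ has |β_n(1/n) − β_n(0)| = 2 with 1/n ≤ η; hence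
`bump_no_uniform_lipschitzAtZero` (no step-uniform modulus Λ·s — so no step-uniform first-derivative bound in g², no n-uniform (3.73):
the readings CITATION-FIT R2-F9 found load-bearing) and `bump_no_uniform_complexBound` (no uniformly bounded analytic continuation to
ANY complex disc |g²| < ρ along any tail — [I] p. 266's analytic alternative on a step-uniform disc excludes the bump; kernel proof by
Schwarz's lemma via `EriceFlowEnclosureLowerAtZero.lipschitzAtZero_of_complexBound`, no residue calculus although the continuation
−1 + 4nz/(1+n²z²) visibly has poles at ±i/n → 0); `atZero_hypotheses_sharp` packages the three facts in the letters of §1.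
0 `def`, 0 `sorry`; imports the two siblings only.  Value = necessity witness for the citation fit (Z-FIT-2/Z-FIT-3 of the sibling);
NOT `BetaPertH`, NOT continuum, NOT Clay.
-/

namespace Summit.QuantumFields.BalabanUV.Beta.EriceFlowEnclosureLowerAtZeroSharp

open Filter Set Metric
open scoped Topology
open Literature.MathematicalPhysics.QuantumFieldTheory.BalabanJaffe1986.BJ86CouplingRenormalization
open Summit.QuantumFields.BalabanUV.Beta.EriceFlowEnclosureLowerNoGo
open Summit.QuantumFields.BalabanUV.Beta.EriceFlowEnclosureLowerAtZero

noncomputable section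

/-! ## §3 Necessity: the travelling bump is not equicontinuous at zero along any tail -/

/-- The bump sits at `−1` at zero coupling for EVERY n: the sign input of §1 holds with `c = 1` from `n₀ = 0`. [folklore] -/
theorem bump_zero (n : ℕ) : bump n 0 = -1 := by
  simp [bump]

/-- **The bump family is NOT equicontinuous at g² = 0 along any tail**: for every threshold `n₀` and every `η > 0` some `n ≥ n₀`
and some `s ∈ [0,η]` (namely `s = 1/n`) have `|β_n(s) − β_n(0)| = 2`.  With `bump_zero` (sign at zero, c = 1, all n),
`bump_unifBoundedConvergent369` (bound and pointwise convergence), `bump_negativeNearZero369` and `bump_continuous`, this isolates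
the equicontinuity at zero as the load-bearing regularity input of §1 — consistent with `bump_not_sandwich369` and with prover 1's
`EriceFlowEnclosureNecessity.not_endpointExistence_of_forwardGenerated_bump`. [folklore] -/
theorem bump_not_equicontAtZero (n₀ : ℕ) {η : ℝ} (hη : 0 < η) :
    ∃ n, n₀ ≤ n ∧ ∃ s : ℝ, 0 ≤ s ∧ s ≤ η ∧ |bump n s - bump n 0| = 2 := by
  set N : ℕ := max n₀ (⌈1 / η⌉₊ + 1) with hN
  have hNn₀ : n₀ ≤ N := le_max_left _ _
  have hN1 : ⌈1 / η⌉₊ + 1 ≤ N := le_max_right _ _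
  have hNpos : 0 < N := lt_of_lt_of_le (Nat.succ_pos _) hN1
  have hNreal : 1 / η < (N : ℝ) := by
    have h1 : 1 / η ≤ (⌈1 / η⌉₊ : ℝ) := Nat.le_ceil _
    have h2 : ((⌈1 / η⌉₊ + 1 : ℕ) : ℝ) ≤ N := by exact_mod_cast hN1
    push_cast at h2
    linarith
  have hNpos' : 0 < (N : ℝ) := by exact_mod_cast hNpos
  refine ⟨N, hNn₀, 1 / (N : ℝ), by positivity, ((one_div_lt hNpos' hη).mpr hNreal).le, ?_⟩
  rw [bump_at_inv hNpos, bump_zero]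
  norm_num

/-- Hence **NO step-uniform Lipschitz-at-zero constant** for the bump family: there are no `Λ`, `δ > 0`, `n₀` with
`|β_n(s) − β_n(0)| ≤ Λ·s` on [0,δ] for all `n ≥ n₀` (at `s = 1/n ≤ min δ (1/(|Λ|+1))` the left side is 2, the right side < 1).
In particular no step-uniform first-derivative bound in g² ((b)) and no n-uniform (3.73) ((e)) — the readings CITATION-FIT R2-F9
found load-bearing. [folklore] -/
theorem bump_no_uniform_lipschitzAtZero :
    ¬ ∃ (Λ δ : ℝ) (n₀ : ℕ), 0 < δ ∧ ∀ n, n₀ ≤ n → ∀ s : ℝ, 0 ≤ s → s ≤ δ → |bump n s - bump n 0| ≤ Λ * s := by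
  rintro ⟨Λ, δ, n₀, hδ, h⟩
  have hη : 0 < min δ (1 / (|Λ| + 1)) := lt_min hδ (by positivity)
  obtain ⟨n, hn, s, hs, hsη, heq⟩ := bump_not_equicontAtZero n₀ hη
  have hsδ : s ≤ δ := hsη.trans (min_le_left _ _)
  have hs1 : s ≤ 1 / (|Λ| + 1) := hsη.trans (min_le_right _ _)
  have hle := h n hn s hs hsδ
  rw [heq] at hle
  have hΛs : Λ * s ≤ |Λ| * s := mul_le_mul_of_nonneg_right (le_abs_self Λ) hs
  have hkey : |Λ| * s ≤ |Λ| * (1 / (|Λ| + 1)) := mul_le_mul_of_nonneg_left hs1 (abs_nonneg Λ)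
  have hlt : |Λ| * (1 / (|Λ| + 1)) < 1 := by
    rw [mul_one_div, div_lt_one (by positivity)]
    linarith
  linarith

/-- Hence **NO uniformly bounded analytic continuation of the bump family to any complex disc about g² = 0 along any tail**
((d′) contraposed): there are no `ρ > 0`, `M`, `n₀` and functions `F_n` complex differentiable on `|z| < ρ`, bounded by `M`
there, agreeing with `β_n` on `[0,ρ[` for all `n ≥ n₀`.  (The bump's continuation `−1 + 4nz/(1 + n²z²)` has poles at `z = ± i/n →
0`; the kernel proof needs no residue calculus — Schwarz's lemma and `bump_no_uniform_lipschitzAtZero` suffice.)  So the p. 266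
analytic alternative read on a step-uniform disc EXCLUDES the bump, as the uniform reading of «convergent» does
(`bump_not_tendstoUniformlyOn`). [folklore] -/
theorem bump_no_uniform_complexBound :
    ¬ ∃ (ρ M : ℝ) (n₀ : ℕ) (F : ℕ → ℂ → ℂ), 0 < ρ ∧ (∀ n, n₀ ≤ n → DifferentiableOn ℂ (F n) (Metric.ball 0 ρ)) ∧
      (∀ n, n₀ ≤ n → ∀ z ∈ Metric.ball (0 : ℂ) ρ, ‖F n z‖ ≤ M) ∧
      (∀ n, n₀ ≤ n → ∀ s : ℝ, 0 ≤ s → s < ρ → F n s = bump n s) := by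
  rintro ⟨ρ, M, n₀, F, hρ, hF, hM, hFE⟩
  have hlip := lipschitzAtZero_of_complexBound hρ hF hM hFE
  exact bump_no_uniform_lipschitzAtZero
    ⟨2 * M / ρ, ρ / 2, n₀, by linarith, fun n hn s hs hsδ => hlip n hn s hs (by linarith)⟩

/-- **Summary negative in the letters of §1**: the bump family meets the sign at zero (c = 1, every n) and the uniform bound (M = 1 on
g² ≥ 0), yet for EVERY threshold n₀ and EVERY range η > 0 the tolerance-½ equicontinuity at zero on [0,η] FAILS from n₀ — so in
`sandwich369_of_equicontAtZero` the equicontinuity hypothesis cannot be dropped (and indeed `bump_not_sandwich369`). [folklore] -/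
theorem atZero_hypotheses_sharp :
    (∀ n, bump n 0 ≤ -1) ∧ (∀ n, ∀ s : ℝ, 0 ≤ s → |bump n s| ≤ 1) ∧
      ∀ (n₀ : ℕ) (η : ℝ), 0 < η → ¬ ∀ n, n₀ ≤ n → ∀ s ∈ Set.Icc (0 : ℝ) η, |bump n s - bump n 0| ≤ 1 / 2 := by
  refine ⟨fun n => by rw [bump_zero], fun n s hs => abs_le.mpr (bump_mem_Icc n hs), fun n₀ η hη h => ?_⟩
  obtain ⟨n, hn, s, hs, hsη, heq⟩ := bump_not_equicontAtZero n₀ hη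
  have := h n hn s ⟨hs, hsη⟩
  rw [heq] at this
  norm_num at this

end

end Summit.QuantumFields.BalabanUV.Beta.EriceFlowEnclosureLowerAtZeroSharp
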